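import Summits.QuantumFields.YangMills.Theorems.HyperbolicRegulatorCurvatureAnchorRDefs
import Mathlib.LinearAlgebra.Matrix.PosDef
import Mathlib.Analysis.SpecialFunctions.Trigonometric.DerivHyp

/-!
# Stub `stub_ct` of line `witten_hessian` (crux `CurvatureAnchorR`, stmt-QuantumFields-18155)

The finite-matrix Combes–Thomas lemma with the square-root rate, `CombesThomasSqrt`
(stated in `Theorems/HyperbolicRegulatorCurvatureAnchorRDefs.lean`): a real symmetric matrix `H`
on a finite pseudometric index set with `H - m² • 1` positive semidefinite (`m > 0`), hopping of
range `1` and absolute off-diagonal row sums `≤ τ` satisfies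
`|H⁻¹ x y| ≤ (2/m²)·exp(-μ·d x y)` for every `μ ≥ 0` with `(cosh μ − 1)·τ ≤ m²/2`.

Proof (energy estimate for the conjugated operator).  Fix the column `y` and put
`w z := exp(μ·d y z) · H⁻¹ z y`.  From `H * H⁻¹ = 1` one gets the identity
`∑ₐ ∑_b w a · w b · H a b · exp(μ(d y a − d y b)) = w y`; symmetrising in `(a, b)` with
`H` symmetric replaces `exp` by `cosh`, so that
`w y = ⟨w, H w⟩ + ∑ₐ ∑_b w a · w b · H a b · (cosh(μ(d y a − d y b)) − 1)`.
On the support of `H` off the diagonal `|d y a − d y b| ≤ d a b ≤ 1`, hence the last factor lies in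
`[0, cosh μ − 1]`, and a Schur-test bound with the row sums gives the remainder `≥ −(m²/2)‖w‖²`,
while `⟨w, H w⟩ ≥ m²‖w‖²`.  Hence `(m²/2)‖w‖² ≤ w y ≤ ‖w‖`, so `‖w‖ ≤ 2/m²`, and finally
`|H⁻¹ x y| = exp(−μ·d y x)·|w x| ≤ (2/m²)·exp(−μ·d x y)`.
-/

set_option autoImplicit false

namespace Summit.QuantumFields.YangMills.Cruxes.CurvatureAnchorR.WittenHessian

open scoped BigOperators Matrix
open Finset

/-- From `v² ≤ S` and the energy inequality `(m²/2)·S ≤ √S` conclude `|v| ≤ 2/m²`. -/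
private lemma abs_le_of_energy {m S v : ℝ} (hm : 0 < m) (hS : 0 ≤ S) (hv : v ^ 2 ≤ S)
    (h : m ^ 2 / 2 * S ≤ Real.sqrt S) : |v| ≤ 2 / m ^ 2 := by
  have hvs : |v| ≤ Real.sqrt S := Real.abs_le_sqrt hv
  have hm2 : 0 < m ^ 2 := by positivity
  set s := Real.sqrt S with hs
  have hs0 : 0 ≤ s := Real.sqrt_nonneg S
  have hSs : S = s ^ 2 := (Real.sq_sqrt hS).symm
  rw [hSs] at h
  rcases eq_or_lt_of_le hs0 with h0 | hpos
  · rw [← h0] at hvs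
    exact hvs.trans (by positivity)
  · have h1 : m ^ 2 / 2 * s ≤ 1 := by
      have : m ^ 2 / 2 * s * s ≤ 1 * s := by nlinarith
      exact le_of_mul_le_mul_right this hpos
    have h2 : s ≤ 2 / m ^ 2 := by
      rw [le_div_iff₀ hm2]
      nlinarith
    exact hvs.trans h2

/-- For `|t| ≤ 1` and `μ ≥ 0`: `0 ≤ cosh(μ t) − 1 ≤ cosh μ − 1`. -/
private lemma cosh_sub_one_bounds {μ t : ℝ} (hμ : 0 ≤ μ) (ht : |t| ≤ 1) :
    0 ≤ Real.cosh (μ * t) - 1 ∧ Real.cosh (μ * t) - 1 ≤ Real.cosh μ - 1 := by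
  refine ⟨sub_nonneg.mpr (Real.one_le_cosh _), sub_le_sub_right ?_ 1⟩
  rw [Real.cosh_le_cosh, abs_mul, abs_of_nonneg hμ]
  calc μ * |t| ≤ μ * 1 := mul_le_mul_of_nonneg_left ht hμ
    _ = μ := mul_one μ

/-- Termwise Schur bound: if `0 ≤ c ≤ C` then `wa·wb·h·c ≥ −(C/2)·|h|·(wa² + wb²)`. -/
private lemma term_lower_bound {wa wb h c C : ℝ} (hc : 0 ≤ c) (hcC : c ≤ C) :
    -(C / 2 * |h| * (wa ^ 2 + wb ^ 2)) ≤ wa * wb * h * c := by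
  have h1 : |wa * wb| ≤ (wa ^ 2 + wb ^ 2) / 2 := by
    rw [abs_mul]
    nlinarith [two_mul_le_add_sq |wa| |wb|, sq_abs wa, sq_abs wb]
  have h2 : -(|wa * wb * h| * c) ≤ wa * wb * h * c := by
    rw [← neg_mul]
    exact mul_le_mul_of_nonneg_right (neg_abs_le _) hc
  have h3 : |wa * wb * h| * c ≤ |wa * wb * h| * C := mul_le_mul_of_nonneg_left hcC (abs_nonneg _)
  have h4 : |wa * wb * h| * C ≤ (wa ^ 2 + wb ^ 2) / 2 * |h| * C := by
    rw [abs_mul (wa * wb) h]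
    exact mul_le_mul_of_nonneg_right (mul_le_mul_of_nonneg_right h1 (abs_nonneg _))
      (hc.trans hcC)
  have h5 : (wa ^ 2 + wb ^ 2) / 2 * |h| * C = C / 2 * |h| * (wa ^ 2 + wb ^ 2) := by ring
  linarith

/-- **Stub `stub_ct`** (registered stub of line `witten_hessian`): the finite-matrix
Combes–Thomas lemma with the square-root rate, `CombesThomasSqrt`. -/
theorem stub_ct : CombesThomasSqrt := by
  intro ι _ _ d H m τ μ hd0 hdsymm hdtri hHsymm hP hm hrange hrow hμ hcosh x y
  -- Step 1: `H` is positive definite, hence `H * H⁻¹ = 1`.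
  have hHpd : H.PosDef := by
    have h1 : (m ^ 2 • (1 : Matrix ι ι ℝ)).PosDef := Matrix.PosDef.one.smul (pow_pos hm 2)
    simpa using Matrix.PosDef.posSemidef_add hP h1
  have hdet : IsUnit H.det := (Matrix.isUnit_iff_isUnit_det H).mp hHpd.isUnit
  have hmulinv : ∀ a, ∑ b, H a b * H⁻¹ b y = if a = y then 1 else 0 := by
    intro a
    have := congrFun (congrFun (Matrix.mul_nonsing_inv H hdet) a) y
    rwa [Matrix.mul_apply, Matrix.one_apply] at this
  -- Step 2: the conjugated column `w` and the key identity.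
  obtain ⟨w, hw⟩ : ∃ w : ι → ℝ, ∀ z, w z = Real.exp (μ * (d y z : ℝ)) * H⁻¹ z y :=
    ⟨_, fun _ => rfl⟩
  have hkey : ∑ a, ∑ b, w a * w b * H a b * Real.exp (μ * ((d y a : ℝ) - d y b)) = w y := by
    have inner : ∀ a, ∑ b, w a * w b * H a b * Real.exp (μ * ((d y a : ℝ) - d y b))
        = w a * Real.exp (μ * (d y a : ℝ)) * (if a = y then 1 else 0) := by
      intro a
      rw [← hmulinv a, Finset.mul_sum]
      refine Finset.sum_congr rfl fun b _ => ?_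
      have heab : Real.exp (μ * (d y b : ℝ)) * Real.exp (μ * ((d y a : ℝ) - d y b))
          = Real.exp (μ * (d y a : ℝ)) := by
        rw [← Real.exp_add]; congr 1; ring
      rw [hw b]
      linear_combination (w a * H⁻¹ b y * H a b) * heab
    rw [Finset.sum_congr rfl fun a _ => inner a]
    simp only [mul_ite, mul_one, mul_zero, Finset.sum_ite_eq', Finset.mem_univ, if_true]
    simp [hd0]
  -- Step 3: symmetrisation, `exp ↦ cosh`.
  have hsymm : ∑ a, ∑ b, w a * w b * H a b * Real.exp (μ * ((d y a : ℝ) - d y b))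
      = ∑ a, ∑ b, w a * w b * H a b * Real.exp (-(μ * ((d y a : ℝ) - d y b))) := by
    rw [Finset.sum_comm]
    refine Finset.sum_congr rfl fun a _ => Finset.sum_congr rfl fun b _ => ?_
    rw [hHsymm.apply a b, show μ * ((d y b : ℝ) - d y a) = -(μ * ((d y a : ℝ) - d y b)) by ring]
    ring
  have hS : ∑ a, ∑ b, w a * w b * H a b * Real.cosh (μ * ((d y a : ℝ) - d y b)) = w y := by
    have e1 : ∑ a, ∑ b, w a * w b * H a b * Real.cosh (μ * ((d y a : ℝ) - d y b))
        = (∑ a, ∑ b, w a * w b * H a b * Real.exp (μ * ((d y a : ℝ) - d y b))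
          + ∑ a, ∑ b, w a * w b * H a b * Real.exp (-(μ * ((d y a : ℝ) - d y b)))) / 2 := by
      rw [← Finset.sum_add_distrib, Finset.sum_div]
      refine Finset.sum_congr rfl fun a _ => ?_
      rw [← Finset.sum_add_distrib, Finset.sum_div]
      refine Finset.sum_congr rfl fun b _ => ?_
      rw [Real.cosh_eq]; ring
    rw [e1, ← hsymm, hkey]; ring
  have hsplit : w y = (∑ a, ∑ b, w a * w b * H a b)
      + ∑ a, ∑ b, w a * w b * H a b * (Real.cosh (μ * ((d y a : ℝ) - d y b)) - 1) := by
    rw [← hS, ← Finset.sum_add_distrib]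
    refine Finset.sum_congr rfl fun a _ => ?_
    rw [← Finset.sum_add_distrib]
    refine Finset.sum_congr rfl fun b _ => ?_
    ring
  -- Step 4: coercivity `⟨w, H w⟩ ≥ m² ‖w‖²`.
  have hcoer : m ^ 2 * ∑ a, w a ^ 2 ≤ ∑ a, ∑ b, w a * w b * H a b := by
    have h0 := hP.dotProduct_mulVec_nonneg w
    have e : star w ⬝ᵥ ((H - m ^ 2 • (1 : Matrix ι ι ℝ)) *ᵥ w)
        = (∑ a, ∑ b, w a * w b * H a b) - m ^ 2 * ∑ a, w a ^ 2 := by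
      rw [star_trivial, Matrix.sub_mulVec, dotProduct_sub, Matrix.smul_mulVec, Matrix.one_mulVec,
        dotProduct_smul, smul_eq_mul]
      congr 1
      · simp only [dotProduct, Matrix.mulVec, Finset.mul_sum]
        refine Finset.sum_congr rfl fun a _ => Finset.sum_congr rfl fun b _ => ?_
        ring
      · simp only [dotProduct]
        congr 1
        refine Finset.sum_congr rfl fun a _ => ?_
        ring
    rw [e] at h0
    linarith
  -- Step 5: Schur bound on the remainder.
  obtain ⟨K, hK⟩ : ∃ K : ι → ι → ℝ, ∀ a b, K a b = if a = b then 0 else |H a b| :=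
    ⟨_, fun _ _ => rfl⟩
  have hKrow : ∀ a, ∑ b, K a b ≤ τ := by
    intro a
    have : ∑ b, K a b = ∑ b ∈ Finset.univ.erase a, |H a b| := by
      rw [← Finset.sum_erase (s := Finset.univ) (f := fun b => K a b) (a := a) (by simp [hK])]
      refine Finset.sum_congr rfl fun b hb => ?_
      rw [hK, if_neg (Ne.symm (Finset.mem_erase.mp hb).1)]
    rw [this]
    exact hrow a
  have hKsymm : ∀ a b, K a b = K b a := by
    intro a b
    rw [hK, hK]
    by_cases h : a = b
    · subst h; rfl
    · rw [if_neg h, if_neg (Ne.symm h), hHsymm.apply b a]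
  have hterm : ∀ a b, -((Real.cosh μ - 1) / 2 * K a b * (w a ^ 2 + w b ^ 2))
      ≤ w a * w b * H a b * (Real.cosh (μ * ((d y a : ℝ) - d y b)) - 1) := by
    intro a b
    by_cases hab : a = b
    · subst hab
      simp [hK]
    · by_cases hH : H a b = 0
      · simp [hK, hab, hH]
      · have hd1 : d a b ≤ 1 := not_lt.mp (mt (hrange a b) hH)
        have hd1' : (d a b : ℝ) ≤ 1 := by exact_mod_cast hd1
        have ht : |((d y a : ℝ) - d y b)| ≤ 1 := by
          rw [abs_le]
          constructor
          · have h1 : d y b ≤ d y a + d a b := hdtri y a b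
            have h1' : (d y b : ℝ) ≤ d y a + d a b := by exact_mod_cast h1
            linarith
          · have h1 : d y a ≤ d y b + d b a := hdtri y b a
            rw [hdsymm b a] at h1
            have h1' : (d y a : ℝ) ≤ d y b + d a b := by exact_mod_cast h1
            linarith
        have hc := cosh_sub_one_bounds hμ ht
        rw [hK, if_neg hab]
        exact term_lower_bound hc.1 hc.2
  have hS0 : 0 ≤ ∑ a, w a ^ 2 := Finset.sum_nonneg fun a _ => sq_nonneg _
  have hR : -(m ^ 2 / 2 * ∑ a, w a ^ 2)
      ≤ ∑ a, ∑ b, w a * w b * H a b * (Real.cosh (μ * ((d y a : ℝ) - d y b)) - 1) := by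
    have h1 : -((Real.cosh μ - 1) / 2 * ∑ a, ∑ b, K a b * (w a ^ 2 + w b ^ 2))
        ≤ ∑ a, ∑ b, w a * w b * H a b * (Real.cosh (μ * ((d y a : ℝ) - d y b)) - 1) := by
      rw [Finset.mul_sum, ← Finset.sum_neg_distrib]
      refine Finset.sum_le_sum fun a _ => ?_
      rw [Finset.mul_sum, ← Finset.sum_neg_distrib]
      refine Finset.sum_le_sum fun b _ => ?_
      have := hterm a b
      rwa [← mul_assoc]
    have h2 : ∑ a, ∑ b, K a b * (w a ^ 2 + w b ^ 2) ≤ 2 * τ * ∑ a, w a ^ 2 := by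
      have e : ∑ a, ∑ b, K a b * (w a ^ 2 + w b ^ 2)
          = ∑ a, w a ^ 2 * ∑ b, K a b + ∑ b, w b ^ 2 * ∑ a, K a b := by
        simp only [mul_add, Finset.sum_add_distrib]
        congr 1
        · refine Finset.sum_congr rfl fun a _ => ?_
          rw [Finset.mul_sum]
          refine Finset.sum_congr rfl fun b _ => ?_
          ring
        · rw [Finset.sum_comm]
          refine Finset.sum_congr rfl fun b _ => ?_
          rw [Finset.mul_sum]
          refine Finset.sum_congr rfl fun a _ => ?_
          ring
      rw [e]
      have hb1 : ∑ a, w a ^ 2 * ∑ b, K a b ≤ ∑ a, w a ^ 2 * τ :=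
        Finset.sum_le_sum fun a _ => mul_le_mul_of_nonneg_left (hKrow a) (sq_nonneg _)
      have hb2 : ∑ b, w b ^ 2 * ∑ a, K a b ≤ ∑ b, w b ^ 2 * τ := by
        refine Finset.sum_le_sum fun b _ => mul_le_mul_of_nonneg_left ?_ (sq_nonneg _)
        rw [show ∑ a, K a b = ∑ a, K b a from Finset.sum_congr rfl fun a _ => hKsymm a b]
        exact hKrow b
      rw [← Finset.sum_mul] at hb1 hb2
      linarith
    have hC0 : 0 ≤ (Real.cosh μ - 1) / 2 := by linarith [Real.one_le_cosh μ]
    have h3 : (Real.cosh μ - 1) / 2 * ∑ a, ∑ b, K a b * (w a ^ 2 + w b ^ 2)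
        ≤ m ^ 2 / 2 * ∑ a, w a ^ 2 :=
      calc (Real.cosh μ - 1) / 2 * ∑ a, ∑ b, K a b * (w a ^ 2 + w b ^ 2)
          ≤ (Real.cosh μ - 1) / 2 * (2 * τ * ∑ a, w a ^ 2) := mul_le_mul_of_nonneg_left h2 hC0
        _ = ((Real.cosh μ - 1) * τ) * ∑ a, w a ^ 2 := by ring
        _ ≤ (m ^ 2 / 2) * ∑ a, w a ^ 2 := mul_le_mul_of_nonneg_right hcosh hS0
    linarith
  -- Step 6: the energy inequality and the bound on `w`.
  have hwy : m ^ 2 / 2 * ∑ a, w a ^ 2 ≤ w y := by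
    rw [hsplit]
    linarith [hcoer, hR]
  have hsq : ∀ z, w z ^ 2 ≤ ∑ a, w a ^ 2 := fun z =>
    Finset.single_le_sum (f := fun a => w a ^ 2) (fun a _ => sq_nonneg (w a)) (Finset.mem_univ z)
  have hwy' : m ^ 2 / 2 * ∑ a, w a ^ 2 ≤ Real.sqrt (∑ a, w a ^ 2) :=
    hwy.trans ((le_abs_self _).trans (Real.abs_le_sqrt (hsq y)))
  have hwx : |w x| ≤ 2 / m ^ 2 := abs_le_of_energy hm hS0 (hsq x) hwy'
  -- Step 7: undo the conjugation.
  have hfin : H⁻¹ x y = Real.exp (-(μ * d x y)) * w x := by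
    rw [hw x, hdsymm y x, Real.exp_neg, ← mul_assoc, inv_mul_cancel₀ (Real.exp_ne_zero _), one_mul]
  rw [hfin, abs_mul, Real.abs_exp, mul_comm]
  exact mul_le_mul_of_nonneg_right hwx (Real.exp_nonneg _)

end Summit.QuantumFields.YangMills.Cruxes.CurvatureAnchorR.WittenHessian
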